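import Literature.Analysis.FluidPDE.RadialSmoothCutoff
import HarnessLib

/-!
# Mass-export tools I: scaled smooth cutoffs with absolute constants
  (crux `MixingPayoff`, stmt-NavierStokesRegularity-1422, line `birth`)

Helper file (`--supports stmt-NavierStokesRegularity-1422`, anchor `mexaux_existsCutoff`) for
`mixingPayoff_massExport` (file `SelfMixingDichotomyMixingPayoffMassExport`), the
"mass export" constraint on the open heart `stub_mixingForcesTypeI` of the line: `δ`-mixing at
scale `r` forces speed `≳ δ^{-2/3}/r` on the window. The argument tests the advected scalar
against a smooth cutoff of a ball `B̄(x₀, R)` whose gradient and Laplacian obey the scaling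
bounds `‖Dψ‖ ≤ C₁/R`, `|Δψ| ≤ C₂/R²` with ABSOLUTE constants; this file supplies it:

* `mexaux_existsCutoff` — there are `C₁, C₂ > 0` such that for every centre `x₀ ∈ ℝ³` and
  radius `R > 0` there is `ψ ∈ C²(ℝ³; [0, 1])` with `ψ = 1` on `B̄(x₀, R)`, `ψ = 0` and
  `Dψ = 0` where `dist(x, x₀) ≥ 2R`, `‖Dψ(x)‖ ≤ C₁/R`, `|Δψ(x)| ≤ C₂/R²` everywhere, and `ψ`,
  `Dψ`, `D²ψ` bounded. It is the translate `x ↦ smoothTransition (2 − ‖x − x₀‖²/R²)` of the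
  tree's radial cutoff (`RadialSmoothCutoff`: `exists_norm_fderiv_smoothTransition_cutoff_le`,
  `exists_abs_laplacian_smoothTransition_cutoff_le`), using translation invariance of `fderiv`
  (`fderiv_comp_sub`) and of `Δ` (`iteratedFDeriv_comp_sub` in an orthonormal frame).

Everything is proved (standard axioms); no definitions, no named facts. Reference: L. C. Evans,
*Partial Differential Equations*, 2nd ed. (AMS 2010), App. C.4 (cutoff functions).
-/

noncomputable section

open Literature.Analysis.FluidPDE MeasureTheory Set Function Metric Filter Topology
open scoped ContDiff InnerProductSpace Laplacian

-- `Summit = Problem` for this summit; the tree lakefile sets `weak.linter.dupNamespace = false`,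
-- made explicit here for out-of-tree `lean check`.
set_option linter.dupNamespace false

namespace Summit.NavierStokesRegularity.NavierStokesRegularity.Theorems

local notation "E3" => EuclideanSpace ℝ (Fin 3)

/-! ### Scaled cutoffs -/

/-- **Scaled smooth cutoffs with absolute constants.** There are `C₁, C₂ > 0` such that for all
`x₀ ∈ ℝ³`, `R > 0` there is `ψ ∈ C²(ℝ³; [0, 1])` with `ψ = 1` on `B̄(x₀, R)`, `ψ = 0` and
`Dψ = 0` on `{dist(x, x₀) ≥ 2R}`, `‖Dψ(x)‖ ≤ C₁/R`, `|Δψ(x)| ≤ C₂/R²` for all `x`, and `ψ`,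
`Dψ`, `D²ψ` bounded. Construction: `ψ(x) = smoothTransition (2 − ‖x − x₀‖²/R²)`, the translate
of the radial cutoff of `RadialSmoothCutoff` (gradient and Laplacian bounds
`exists_norm_fderiv_smoothTransition_cutoff_le`, `exists_abs_laplacian_smoothTransition_cutoff_le`;
translation invariance of `fderiv` and of `Δ`). -/
theorem mexaux_existsCutoff :
    ∃ C₁ C₂ : ℝ, 0 < C₁ ∧ 0 < C₂ ∧ ∀ (x₀ : E3) (R : ℝ), 0 < R →
      ∃ ψ : E3 → ℝ, ContDiff ℝ 2 ψ ∧ (∀ x, 0 ≤ ψ x) ∧ (∀ x, ψ x ≤ 1) ∧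
        (∀ x, dist x x₀ ≤ R → ψ x = 1) ∧ (∀ x, 2 * R ≤ dist x x₀ → ψ x = 0) ∧
        (∀ x, 2 * R ≤ dist x x₀ → fderiv ℝ ψ x = 0) ∧
        (∀ x, ‖fderiv ℝ ψ x‖ ≤ C₁ / R) ∧ (∀ x, |(Laplacian.laplacian ψ) x| ≤ C₂ / R ^ 2) ∧
        ∃ M : ℝ, ∀ x, ‖ψ x‖ ≤ M ∧ ‖fderiv ℝ ψ x‖ ≤ M ∧ ‖fderiv ℝ (fderiv ℝ ψ) x‖ ≤ M := by
  obtain ⟨c₁, hc₁, h₁⟩ := exists_norm_fderiv_smoothTransition_cutoff_le (E := E3)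
  obtain ⟨c₂, hc₂, h₂⟩ := exists_abs_laplacian_smoothTransition_cutoff_le (E := E3)
  refine ⟨c₁ + 1, c₂ + 1, by linarith, by linarith, fun x₀ R hR => ?_⟩
  set χ : E3 → ℝ := fun z => Real.smoothTransition (2 - ‖z‖ ^ 2 / R ^ 2) with hχ
  have hχs : ContDiff ℝ 2 χ := contDiff_smoothTransition_cutoff (n := 2) R
  set ψ : E3 → ℝ := fun x => χ (x - x₀) with hψ
  have hψs : ContDiff ℝ 2 ψ := hχs.comp (contDiff_id.sub contDiff_const)
  -- vanishing on the open set `{3R/2 < dist x x₀}`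
  have hzero : ∀ x : E3, 3 * R / 2 < dist x x₀ → ψ x = 0 := by
    intro x hx
    simp only [hψ, hχ]
    apply Real.smoothTransition.zero_of_nonpos
    rw [dist_eq_norm] at hx
    have h9 : (3 * R / 2) ^ 2 ≤ ‖x - x₀‖ ^ 2 := pow_le_pow_left₀ (by positivity) hx.le 2
    have h2 : 2 ≤ ‖x - x₀‖ ^ 2 / R ^ 2 := by
      rw [le_div_iff₀ (by positivity)]
      nlinarith
    linarith
  have hzero' : ∀ x : E3, 2 * R ≤ dist x x₀ → ψ x = 0 := fun x hx =>
    hzero x (lt_of_lt_of_le (by linarith) hx)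
  have hDzero : ∀ x : E3, 2 * R ≤ dist x x₀ → fderiv ℝ ψ x = 0 := by
    intro x hx
    have hev : ψ =ᶠ[𝓝 x] fun _ => (0 : ℝ) := by
      have hopen : IsOpen {y : E3 | 3 * R / 2 < dist y x₀} :=
        isOpen_lt continuous_const (continuous_id.dist continuous_const)
      have hxmem : x ∈ {y : E3 | 3 * R / 2 < dist y x₀} := by
        show 3 * R / 2 < dist x x₀
        linarith
      filter_upwards [hopen.mem_nhds hxmem] with y hy
      exact hzero y hy
    rw [hev.fderiv_eq]
    exact fderiv_const_apply 0
  -- compact support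
  have hψc : HasCompactSupport ψ := by
    refine HasCompactSupport.of_support_subset_isCompact (isCompact_closedBall x₀ (2 * R)) ?_
    intro x hx
    rw [mem_closedBall]
    by_contra h
    exact hx (hzero' x (not_le.1 h).le)
  refine ⟨ψ, hψs, fun x => Real.smoothTransition.nonneg _, fun x => Real.smoothTransition.le_one _,
    ?_, hzero', hDzero, ?_, ?_, ?_⟩
  · -- plateau
    intro x hx
    rw [dist_eq_norm] at hx
    exact smoothTransition_cutoff_eq_one hR hx
  · -- gradient bound
    intro x
    have e : fderiv ℝ ψ x = fderiv ℝ χ (x - x₀) := fderiv_comp_sub x₀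
    rw [e]
    exact (h₁ R hR (x - x₀)).trans (div_le_div_of_nonneg_right (by linarith) hR.le)
  · -- Laplacian bound
    intro x
    have e : (Δ ψ) x = (Δ χ) (x - x₀) := by
      simp only [hψ, InnerProductSpace.laplacian_eq_iteratedFDeriv_stdOrthonormalBasis,
        iteratedFDeriv_comp_sub]
    rw [e]
    exact (h₂ R hR (x - x₀)).trans (div_le_div_of_nonneg_right (by linarith) (by positivity))
  · -- crude bounds on `ψ`, `Dψ`, `D²ψ` (continuous with compact support)
    obtain ⟨M₀, hM₀⟩ := hψs.continuous.bounded_above_of_compact_support hψc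
    obtain ⟨M₁, hM₁⟩ := (hψs.continuous_fderiv two_ne_zero).bounded_above_of_compact_support
      (hψc.fderiv (𝕜 := ℝ))
    obtain ⟨M₂, hM₂⟩ := ((hψs.fderiv_right (m := 1) (by norm_num)).continuous_fderiv
      one_ne_zero).bounded_above_of_compact_support ((hψc.fderiv (𝕜 := ℝ)).fderiv (𝕜 := ℝ))
    exact ⟨max M₀ (max M₁ M₂), fun x => ⟨(hM₀ x).trans (le_max_left _ _),
      (hM₁ x).trans ((le_max_left _ _).trans (le_max_right _ _)),
      (hM₂ x).trans ((le_max_right _ _).trans (le_max_right _ _))⟩⟩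

end Summit.NavierStokesRegularity.NavierStokesRegularity.Theorems

end
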